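import Summits.QuantumAdvantage.QuantumAdvantage.Theorems.FanInRootCollapseA

/-!
# FanInRoot (6/11): the even-stretch COLLAPSE, part B — counting transfers and `collapseLaw3` (an even-stretch hub game on `C_n` IS the bare `C_{|H|}` game); `hubLaw_large`
-/

set_option linter.dupNamespace false -- D-0017: single-problem summit ⇒ `QuantumAdvantage.QuantumAdvantage` by design

namespace Summit.QuantumAdvantage.QuantumAdvantage.Theorems.FanInRoot

open Finset
open Summit.QuantumAdvantage.AdviceFreeQNC0
open Literature.Computability.QuantumComplexity
open Literature.Computability.QuantumComplexity.RingHLF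
open Literature.Computability.MetaComplexity
open scoped Classical

namespace Collapse

variable {n : ℕ} (H : Finset (Fin n))

/-! #### Counting transfers: `|x ∧ v|`, edges, inner products, zero counts -/

/-- FanInRoot helper `hubInst_hubIdx` (lens-1 g6 FanInRoot package; see the module docstring). -/
theorem hubInst_hubIdx (β : Fin H.card → Bool) (a : Fin H.card) : hubInst H β ((H.orderIsoOfFin rfl) a).1 = β a := by
  rw [hubInst_mem H β ((H.orderIsoOfFin rfl) a).2]
  congr 1
  exact (H.orderIsoOfFin rfl).symm_apply_apply a

/-- FanInRoot helper `cls_hubIdx` (lens-1 g6 FanInRoot package; see the module docstring). -/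
theorem cls_hubIdx (hk : 0 < H.card) {c : ℕ} (hc : ∀ h ∈ H, par H h = c) (a : Fin H.card) :
    cls H hk c ((H.orderIsoOfFin rfl) a).1 = a := by
  rw [cls_hub H hk hc ((H.orderIsoOfFin rfl) a).2, ← symm_eq_prv_q H hk ((H.orderIsoOfFin rfl) a).2]
  exact (H.orderIsoOfFin rfl).symm_apply_apply a

/-- FanInRoot helper `ext_hubIdx` (lens-1 g6 FanInRoot package; see the module docstring). -/
theorem ext_hubIdx (hk : 0 < H.card) {c : ℕ} (hc : ∀ h ∈ H, par H h = c) (u : Fin H.card → Bool) (a : Fin H.card) :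
    ext H hk c u ((H.orderIsoOfFin rfl) a).1 = u a := by
  simp only [ext, cls_hubIdx H hk hc a]

/-- FanInRoot helper `wtAnd_ext` (lens-1 g6 FanInRoot package; see the module docstring). -/
theorem wtAnd_ext (hk : 0 < H.card) {c : ℕ} (hc : ∀ h ∈ H, par H h = c) (β u : Fin H.card → Bool) :
    wtAnd (hubInst H β) (ext H hk c u) = wtAnd β u := by
  unfold wtAnd
  have h1 : (univ.filter fun b : Fin n => hubInst H β b = true ∧ ext H hk c u b = true)
      = H.filter (fun b => hubInst H β b = true ∧ ext H hk c u b = true) := by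
    ext b; simp only [mem_filter, mem_univ, true_and]
    constructor
    · rintro ⟨hx, hv⟩
      have hb : b ∈ H := by by_contra hb; simp [hubInst, hb] at hx
      exact ⟨hb, hx, hv⟩
    · rintro ⟨-, hx, hv⟩; exact ⟨hx, hv⟩
  rw [h1, card_filter_hubs H]
  congr 1
  refine Finset.filter_congr fun a _ => ?_
  rw [hubInst_hubIdx H β a, ext_hubIdx H hk hc u a]

/-- FanInRoot helper `offhub_par_ne_nxt_notMem` (lens-1 g6 FanInRoot package; see the module docstring). -/
theorem offhub_par_ne_nxt_notMem (hE : H ∈ EvenStretch n) {c : ℕ} (hc : ∀ h ∈ H, par H h = c) {b : Fin n} (_hb : b ∉ H) (hpc : par H b ≠ c) :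
    nxt b ∉ H := by
  intro hm
  have hpn := par_nxt H hE b
  rw [if_pos hm] at hpn
  have := hc _ hm
  have h2 := par_lt H b
  omega

/-- FanInRoot helper `offhub_par_eq_prv_notMem` (lens-1 g6 FanInRoot package; see the module docstring). -/
theorem offhub_par_eq_prv_notMem (hE : H ∈ EvenStretch n) {c : ℕ} (hc : ∀ h ∈ H, par H h = c) {b : Fin n} (hb : b ∉ H) (hpc : par H b = c) :
    prv b ∉ H := by
  intro hm
  have hpp := par_prv H hE b
  rw [if_neg hb] at hpp
  have := hc _ hm
  have h2 := par_lt H b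
  omega

/-- EDGE TRANSFER: `edgesIn (ext u) = edgesIn u + 2·M` (hub edges ↔ bare edges; off-hub in-edges pair up under `nxt` between odd and even offsets). -/
theorem edgesIn_ext (hE : H ∈ EvenStretch n) (hk : 0 < H.card) {c : ℕ} (hc : ∀ h ∈ H, par H h = c) (u : Fin H.card → Bool) :
    ∃ M : ℕ, edgesIn (ext H hk c u) = edgesIn u + 2 * M := by
  set v := ext H hk c u with hv
  let P : Fin n → Prop := fun b => v b = true ∧ v (nxt b) = true
  let s : Finset (Fin n) := univ.filter P
  have hs : edgesIn v = s.card := rfl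
  -- split by hub membership
  have hsplit := Finset.card_filter_add_card_filter_not (s := s) (fun b => b ∈ H)
  -- hub part = bare edges
  have hH : (s.filter fun b => b ∈ H).card = edgesIn u := by
    have : (s.filter fun b => b ∈ H) = H.filter P := by
      ext b; simp only [s, mem_filter, mem_univ, true_and]; tauto
    rw [this, card_filter_hubs H]
    unfold edgesIn
    congr 1
    refine Finset.filter_congr fun a _ => ?_
    simp only [P, hv, ext_hubIdx H hk hc u a]
    rw [show ext H hk c u (nxt ((H.orderIsoOfFin rfl) a).1) = u (nxt a) by
      simp only [ext, cls_nxt_hub H hE hk hc ((H.orderIsoOfFin rfl) a).2, cls_hubIdx H hk hc a]]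
  -- off-hub part is even
  let E : Finset (Fin n) := s.filter fun b => b ∉ H
  have hEsplit := Finset.card_filter_add_card_filter_not (s := E) (fun b => par H b = c)
  have hbij : (E.filter fun b => ¬ par H b = c).card = (E.filter fun b => par H b = c).card := by
    refine Finset.card_bij (fun b _ => nxt b) (fun b hb => ?_) (fun b₁ _ b₂ _ h => nxt_injective h) (fun b' hb' => ?_)
    · simp only [E, s, P, mem_filter, mem_univ, true_and] at hb ⊢
      obtain ⟨⟨⟨hvb, hvn⟩, hbH⟩, hpc⟩ := hb
      have hnH : nxt b ∉ H := offhub_par_ne_nxt_notMem H hE hc hbH hpc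
      have hpn := par_nxt H hE b
      rw [if_neg hnH] at hpn
      have h2 := par_lt H b
      have hcl : c < 2 := by
        obtain ⟨h₀, hh₀⟩ : H.Nonempty := Finset.card_pos.1 hk
        rw [← hc h₀ hh₀]; exact par_lt H h₀
      refine ⟨⟨⟨hvn, ?_⟩, hnH⟩, by omega⟩
      have := cls_prv_eq_cls_nxt H hE hk hc hnH
      rw [prv_nxt] at this
      simp only [hv, ext] at hvb ⊢; rw [← this]; exact hvb
    · simp only [E, s, P, mem_filter, mem_univ, true_and] at hb'
      obtain ⟨⟨⟨hvb, hvn⟩, hbH⟩, hpc⟩ := hb'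
      have hpH : prv b' ∉ H := offhub_par_eq_prv_notMem H hE hc hbH hpc
      have hpp := par_prv H hE b'
      rw [if_neg hbH] at hpp
      have h2 := par_lt H b'
      refine ⟨prv b', ?_, nxt_prv b'⟩
      simp only [E, s, P, mem_filter, mem_univ, true_and, nxt_prv]
      refine ⟨⟨⟨?_, hvb⟩, hpH⟩, by omega⟩
      have := cls_prv_eq_cls_nxt H hE hk hc hbH
      simp only [hv, ext] at hvn ⊢; rw [this]; exact hvn
  refine ⟨(E.filter fun b => par H b = c).card, ?_⟩
  rw [hs, ← hsplit, hH]
  show edgesIn u + E.card = _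
  rw [← hEsplit, hbij]; ring

/-- SIGN-BIT TRANSFER. -/
theorem signBit_ext (hE : H ∈ EvenStretch n) (hk : 0 < H.card) {c : ℕ} (hc : ∀ h ∈ H, par H h = c) (β u : Fin H.card → Bool) :
    signBit (hubInst H β) (ext H hk c u) = signBit β u := by
  unfold signBit
  obtain ⟨M, hM⟩ := edgesIn_ext H hE hk hc u
  rw [hM, wtAnd_ext H hk hc β u]
  omega

/-- The class-wise XOR fold of an output string: `(π z)_a = ⊕_{cls b = a} z_b`. -/
def fold (hk : 0 < H.card) (c : ℕ) (zx : Fin n → Bool) : Fin H.card → Bool :=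
  fun a => decide ((univ.filter fun b : Fin n => cls H hk c b = a ∧ zx b = true).card % 2 = 1)

/-- INNER-PRODUCT TRANSFER (fibrewise): `⟨ext u, z⟩ ≡ ⟨u, fold z⟩ (mod 2)`. -/
theorem dot2_ext (hk : 0 < H.card) (c : ℕ) (u : Fin H.card → Bool) (zx : Fin n → Bool) :
    dot2 (ext H hk c u) zx = dot2 u (fold H hk c zx) := by
  unfold dot2
  let N : Fin H.card → ℕ := fun a => (univ.filter fun b : Fin n => cls H hk c b = a ∧ zx b = true).card
  let s : Finset (Fin n) := univ.filter fun b : Fin n => ext H hk c u b = true ∧ zx b = true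
  have hfib : s.card = ∑ a : Fin H.card, (s.filter fun b => cls H hk c b = a).card :=
    Finset.card_eq_sum_card_fiberwise (fun b _ => mem_univ _)
  have hfib2 : ∀ a : Fin H.card, (s.filter fun b => cls H hk c b = a).card = if u a = true then N a else 0 := by
    intro a
    by_cases hua : u a = true
    · rw [if_pos hua]
      congr 1
      ext b; simp only [s, mem_filter, mem_univ, true_and, ext]
      constructor
      · rintro ⟨⟨-, hz⟩, hcl⟩; exact ⟨hcl, hz⟩
      · rintro ⟨hcl, hz⟩; exact ⟨⟨by rw [hcl]; exact hua, hz⟩, hcl⟩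
    · rw [if_neg hua, Finset.card_eq_zero]
      ext b; simp only [s, mem_filter, mem_univ, true_and, ext]
      constructor
      · rintro ⟨⟨hu, -⟩, hcl⟩; rw [hcl] at hu; exact absurd hu hua
      · intro hb; simp at hb
  have hL : s.card % 2 = (univ.filter fun a : Fin H.card => u a = true ∧ N a % 2 = 1).card % 2 := by
    rw [hfib, Finset.sum_nat_mod, Finset.card_filter]
    congr 1
    refine Finset.sum_congr rfl fun a _ => ?_
    rw [hfib2 a]
    by_cases hua : u a = true
    · rw [if_pos hua]
      rcases Nat.mod_two_eq_zero_or_one (N a) with h | h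
      · simp [h]
      · simp [h, hua]
    · rw [if_neg hua, if_neg (by simp [hua])]
  rw [show (univ.filter fun b : Fin n => ext H hk c u b = true ∧ zx b = true).card = s.card from rfl, hL]
  congr 2
  ext a; simp only [mem_filter, mem_univ, true_and, fold, decide_eq_true_eq, N]

/-- RELATION TRANSFER: a strategy perfect on a hub instance folds to one perfect on the bare pattern. -/
theorem rel_fold (hE : H ∈ EvenStretch n) (hk : 0 < H.card) {c : ℕ} (hc : ∀ h ∈ H, par H h = c) (β : Fin H.card → Bool) (zx : Fin n → Bool)
    (h : Rel (hubInst H β) zx) : Rel β (fold H hk c zx) := by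
  intro u hu
  have := h (ext H hk c u) (inKernel_ext H hE hk hc β u hu)
  rwa [dot2_ext H hk c u zx, signBit_ext H hE hk hc β u] at this

/-- FanInRoot helper `natCast_zmod2_eq_ite` (lens-1 g6 FanInRoot package; see the module docstring). -/
theorem natCast_zmod2_eq_ite (N : ℕ) : (N : ZMod 2) = if N % 2 = 1 then 1 else 0 := by
  rw [← ZMod.natCast_mod N 2]
  rcases Nat.mod_two_eq_zero_or_one N with h | h <;> simp [h]

/-- DEGREE TRANSFER: folding is `𝔽₂`-linear, so it preserves `Smolensky.lowDeg`. -/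
theorem fold_mem_lowDeg (hk : 0 < H.card) (c : ℕ) (z : (Fin n → Bool) → Fin n → Bool) (r : ℕ)
    (hz : ∀ j : Fin n, (fun β : Fin H.card → Bool => if z (hubInst H β) j = true then (1 : ZMod 2) else 0) ∈ Smolensky.lowDeg (ZMod 2) H.card r)
    (a : Fin H.card) :
    (fun β : Fin H.card → Bool => if fold H hk c (z (hubInst H β)) a = true then (1 : ZMod 2) else 0) ∈ Smolensky.lowDeg (ZMod 2) H.card r := by
  have heq : (fun β : Fin H.card → Bool => if fold H hk c (z (hubInst H β)) a = true then (1 : ZMod 2) else 0)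
      = ∑ b ∈ univ.filter (fun b : Fin n => cls H hk c b = a), (fun β : Fin H.card → Bool => if z (hubInst H β) b = true then (1 : ZMod 2) else 0) := by
    funext β
    rw [Finset.sum_apply]
    simp only [fold, decide_eq_true_eq]
    rw [Finset.sum_filter, ← natCast_zmod2_eq_ite]
    have : (univ.filter fun b : Fin n => cls H hk c b = a ∧ z (hubInst H β) b = true).card
        = ∑ b : Fin n, (if cls H hk c b = a ∧ z (hubInst H β) b = true then 1 else 0) := Finset.card_filter _ _
    rw [this]; push_cast
    refine Finset.sum_congr rfl fun b _ => ?_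
    by_cases h1 : cls H hk c b = a <;> by_cases h2 : z (hubInst H β) b = true <;> simp [h1, h2]
  rw [heq]
  exact Submodule.sum_mem _ fun b _ => hz b

/-- ZERO-COUNT TRANSFER. -/
theorem oddZeros_hubInst (hE : H ∈ EvenStretch n) (β : Fin H.card → Bool) : OddZeros (hubInst H β) ↔ OddZeros β := by
  unfold OddZeros
  let s : Finset (Fin n) := univ.filter fun i : Fin n => hubInst H β i = false
  have hsplit := Finset.card_filter_add_card_filter_not (s := s) (fun b => b ∈ H)
  have h1 : (s.filter fun b => b ∈ H).card = (univ.filter fun a : Fin H.card => β a = false).card := by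
    have : (s.filter fun b => b ∈ H) = H.filter (fun b => hubInst H β b = false) := by
      ext b; simp only [s, mem_filter, mem_univ, true_and]; tauto
    rw [this, card_filter_hubs H]
    congr 1
    refine Finset.filter_congr fun a _ => ?_
    rw [hubInst_hubIdx H β a]
  have h2 : (s.filter fun b => ¬ b ∈ H).card = n - H.card := by
    have : (s.filter fun b => ¬ b ∈ H) = univ \ H := by
      ext b; simp only [s, mem_filter, mem_univ, true_and, mem_sdiff]
      constructor
      · rintro ⟨-, hb⟩; exact hb
      · intro hb; exact ⟨by simp [hubInst, hb], hb⟩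
    rw [this, Finset.card_univ_sdiff, Fintype.card_fin]
  have hkn : H.card ≤ n := by simpa using Finset.card_le_univ H
  have h0 := hE.1
  rw [show (univ.filter fun i : Fin n => hubInst H β i = false).card = s.card from rfl, ← hsplit, h1, h2]
  omega

end Collapse

/-- **THE COLLAPSE LAW IS A THEOREM.**  On an even-stretch configuration the hub game in degree form IS the bare `|H|`-cycle game. -/
theorem collapseLaw3 : ∀ (n r : ℕ) (H : Finset (Fin n)), H ∈ EvenStretch n → 3 ≤ H.card → r ∈ SmallRingLosesDeg H.card → H ∈ HubLosesDeg n r := by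
  intro n r H hE h3 hSmall z hz
  have hk : 0 < H.card := by omega
  obtain ⟨h₀, hh₀⟩ : H.Nonempty := Finset.card_pos.1 hk
  have hc : ∀ h ∈ H, Collapse.par H h = Collapse.par H h₀ := fun h hh => Collapse.par_hub_const H hE hh hh₀
  obtain ⟨β, hodd, hnot⟩ := hSmall (fun β => Collapse.fold H hk (Collapse.par H h₀) (z (hubInst H β)))
    (fun a => Collapse.fold_mem_lowDeg H hk _ z r hz a)
  exact ⟨hubInst H β, hubInst_supported H β, (Collapse.oddZeros_hubInst H hE β).2 hodd,
    fun hrel => hnot (Collapse.rel_fold H hE hk hc β (z (hubInst H β)) hrel)⟩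

/-- For every `r`: all large even-stretch configurations defeat `r`-hub readers (tree `ringHardOdd_two` ∘ collapse). -/
theorem hubLaw_large (r : ℕ) : ∃ K : ℕ, ∀ (n : ℕ) (H : Finset (Fin n)), H ∈ EvenStretch n → K ≤ H.card → H ∈ HubLoses n r := by
  obtain ⟨K, hK⟩ := smallRingLosesDeg_of_large r
  exact ⟨max K 3, fun n H hE hKH => hubLoses_of_hubLosesDeg
    (collapseLaw3 n r H hE (le_trans (le_max_right _ _) hKH) (hK _ (le_trans (le_max_left _ _) hKH)))⟩

end Summit.QuantumAdvantage.QuantumAdvantage.Theorems.FanInRoot
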